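import Mathlib
import Summits.Ventures.HodgeRepro.Tier4.Target
import Summits.Ventures.HodgeRepro.Tier4.Line3.DatumOrthVanishing
import Summits.Ventures.HodgeRepro.Tier4.Line3.OriginRigidity

/-!
# Tier4/Line3/SlotFunctionAlgebra — the slot functions `f(y, z) = w_z^* J y`, their linear part, and the common zero

Blind re-derivation cell `pub-hodge-repro`, Tier 4 «PROVE THE STEP» (README §9–§10), LINE L3, seat t4-L3-p1 (gen 3),
self-cut C-L3-DILCOMP (bus S14565), module 1 of 5 (the chain ends in `Line3/DilationComparisonOfShape`).

* `jform_lift3`: `w_z^* J y = conj(z₀) y₀ + conj(z₁) y₁ − y₂` — conjugate-affine in `z`, with linear part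
  `slotLin y w = conj(w₀) y₀ + conj(w₁) y₁` (`jform_lift3_add`, `slotLin_real_smul`);
* Cramer: `Δ · conj(w₀) = y₁₁ ℓ₀(w) − y₀₁ ℓ₁(w)`, `Δ · conj(w₁) = y₀₀ ℓ₁(w) − y₁₀ ℓ₀(w)` (`cramer_slotLin`), hence the
  two-sided bounds `‖ℓ_y(w)‖² ≤ 2 (‖y₀‖² + ‖y₁‖²) (‖w₀‖² + ‖w₁‖²)` (`slotLin_sq_le`) and
  `‖Δ‖² (‖w₀‖² + ‖w₁‖²) ≤ 4N (‖ℓ₀(w)‖² + ‖ℓ₁(w)‖²)` (`sq_le_slotLin_sq`, `N = Σ ‖y_ij‖²`);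
* `commonZero y₀ y₁` = the common zero `z*` of `f(y₀, ·)`, `f(y₁, ·)` (Cramer on `conj z`), and
  **`commonZero_mem_ball`**: `z* ∈ 𝔹` when the plane `⟨y₀, y₁⟩` is `J`-positive — the `J`-orthogonal line of a
  `J`-positive plane is negative (the vector `p = a y₀ + b y₁` with `(p₀, p₁) = (z*₀, z*₁)` has `p₂ = nsq z*`, so
  `p^* J p = nsq z* (1 − nsq z*)`, positive only if `nsq z* < 1`).

Imports: Mathlib, `Tier4/Target`, `Line3/DatumOrthVanishing` (x2's `jform_eq`) and `Line3/OriginRigidity` (x2's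
`jform_self_re`) by name.  `#print axioms` of every
theorem = `[propext, Classical.choice, Quot.sound]`.  No printed input is consumed.  Nothing here asserts anything about the truth of (P); HC_CM is NOT proved by anyone in this repository.
-/

set_option autoImplicit false

noncomputable section

namespace Summit.Ventures.HodgeRepro.Tier4.Line3

open Summit.Ventures.HodgeRepro.Tier4
open Matrix MeasureTheory
open scoped ComplexConjugate

/-! ## 1. The slot functions `f(y, z) = w_z^* J y`: conjugate-affine in `z`, their linear part, Cramer bounds -/

/-- `w_z^* J y = conj(z₀) y₀ + conj(z₁) y₁ − y₂`. -/
theorem jform_lift3 (z : Fin 2 → ℂ) (y : Fin 3 → ℂ) :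
    star (lift3 z) ⬝ᵥ (J *ᵥ y) = conj (z 0) * y 0 + conj (z 1) * y 1 - y 2 := by
  rw [jform_eq]
  simp [lift3]

/-- The conjugate-linear part of the slot function: `ℓ_y(w) = conj(w₀) y₀ + conj(w₁) y₁`. -/
def slotLin (y : Fin 3 → ℂ) (w : Fin 2 → ℂ) : ℂ := conj (w 0) * y 0 + conj (w 1) * y 1

/-- The slot function is the linear part plus the constant `−y₂`. -/
theorem jform_lift3_eq_slotLin (z : Fin 2 → ℂ) (y : Fin 3 → ℂ) :
    star (lift3 z) ⬝ᵥ (J *ᵥ y) = slotLin y z - y 2 := by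
  rw [jform_lift3]; rfl

/-- Translation: `f(y, w + z) = ℓ_y(w) + f(y, z)`. -/
theorem jform_lift3_add (w z : Fin 2 → ℂ) (y : Fin 3 → ℂ) :
    star (lift3 (w + z)) ⬝ᵥ (J *ᵥ y) = slotLin y w + star (lift3 z) ⬝ᵥ (J *ᵥ y) := by
  rw [jform_lift3, jform_lift3]
  simp only [slotLin, Pi.add_apply, map_add]
  ring

/-- The linear part is homogeneous under real scalars. -/
theorem slotLin_real_smul (t : ℝ) (y : Fin 3 → ℂ) (w : Fin 2 → ℂ) :
    slotLin y (t • w) = (t : ℂ) * slotLin y w := by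
  simp only [slotLin, Pi.smul_apply, Complex.real_smul, map_mul, Complex.conj_ofReal]
  ring

/-- Upper bound on the linear part: `‖ℓ_y(w)‖² ≤ 2 (‖y₀‖² + ‖y₁‖²) (‖w₀‖² + ‖w₁‖²)`. -/
theorem slotLin_sq_le (y : Fin 3 → ℂ) (w : Fin 2 → ℂ) :
    ‖slotLin y w‖ ^ 2 ≤ 2 * (‖y 0‖ ^ 2 + ‖y 1‖ ^ 2) * (‖w 0‖ ^ 2 + ‖w 1‖ ^ 2) := by
  have h1 : ‖slotLin y w‖ ≤ ‖w 0‖ * ‖y 0‖ + ‖w 1‖ * ‖y 1‖ := by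
    unfold slotLin
    calc ‖conj (w 0) * y 0 + conj (w 1) * y 1‖ ≤ ‖conj (w 0) * y 0‖ + ‖conj (w 1) * y 1‖ := norm_add_le _ _
      _ = ‖w 0‖ * ‖y 0‖ + ‖w 1‖ * ‖y 1‖ := by rw [norm_mul, norm_mul, Complex.norm_conj, Complex.norm_conj]
  have h0 : 0 ≤ ‖slotLin y w‖ := norm_nonneg _
  nlinarith [sq_nonneg (‖w 0‖ * ‖y 0‖ - ‖w 1‖ * ‖y 1‖), sq_nonneg (‖w 0‖ * ‖y 1‖), sq_nonneg (‖w 1‖ * ‖y 0‖),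
    mul_nonneg (norm_nonneg (w 0)) (norm_nonneg (y 0)), mul_nonneg (norm_nonneg (w 1)) (norm_nonneg (y 1)),
    sq_nonneg (‖w 0‖ * ‖y 0‖ + ‖w 1‖ * ‖y 1‖)]

/-- Cramer: `Δ · conj(w₀) = y₁₁ ℓ₀(w) − y₀₁ ℓ₁(w)`, `Δ · conj(w₁) = y₀₀ ℓ₁(w) − y₁₀ ℓ₀(w)`. -/
theorem cramer_slotLin (y₀ y₁ : Fin 3 → ℂ) (w : Fin 2 → ℂ) :
    (y₀ 0 * y₁ 1 - y₀ 1 * y₁ 0) * conj (w 0) = y₁ 1 * slotLin y₀ w - y₀ 1 * slotLin y₁ w ∧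
    (y₀ 0 * y₁ 1 - y₀ 1 * y₁ 0) * conj (w 1) = y₀ 0 * slotLin y₁ w - y₁ 0 * slotLin y₀ w := by
  unfold slotLin
  constructor <;> ring

/-- Lower bound on the linear part (the inverse is bounded): with `Δ = y₀₀ y₁₁ − y₀₁ y₁₀` and
`N = ‖y₀₀‖² + ‖y₀₁‖² + ‖y₁₀‖² + ‖y₁₁‖²`, `‖Δ‖² (‖w₀‖² + ‖w₁‖²) ≤ 4 N (‖ℓ₀(w)‖² + ‖ℓ₁(w)‖²)`. -/
theorem sq_le_slotLin_sq (y₀ y₁ : Fin 3 → ℂ) (w : Fin 2 → ℂ) :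
    ‖y₀ 0 * y₁ 1 - y₀ 1 * y₁ 0‖ ^ 2 * (‖w 0‖ ^ 2 + ‖w 1‖ ^ 2) ≤
      4 * (‖y₀ 0‖ ^ 2 + ‖y₀ 1‖ ^ 2 + ‖y₁ 0‖ ^ 2 + ‖y₁ 1‖ ^ 2) * (‖slotLin y₀ w‖ ^ 2 + ‖slotLin y₁ w‖ ^ 2) := by
  obtain ⟨h0, h1⟩ := cramer_slotLin y₀ y₁ w
  have e0 : ‖y₀ 0 * y₁ 1 - y₀ 1 * y₁ 0‖ * ‖w 0‖ ≤ ‖y₁ 1‖ * ‖slotLin y₀ w‖ + ‖y₀ 1‖ * ‖slotLin y₁ w‖ := by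
    have := norm_sub_le (y₁ 1 * slotLin y₀ w) (y₀ 1 * slotLin y₁ w)
    rw [← h0, norm_mul, norm_mul, norm_mul, Complex.norm_conj] at this
    exact this
  have e1 : ‖y₀ 0 * y₁ 1 - y₀ 1 * y₁ 0‖ * ‖w 1‖ ≤ ‖y₀ 0‖ * ‖slotLin y₁ w‖ + ‖y₁ 0‖ * ‖slotLin y₀ w‖ := by
    have := norm_sub_le (y₀ 0 * slotLin y₁ w) (y₁ 0 * slotLin y₀ w)
    rw [← h1, norm_mul, norm_mul, norm_mul, Complex.norm_conj] at this
    exact this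
  have p0 : 0 ≤ ‖y₀ 0 * y₁ 1 - y₀ 1 * y₁ 0‖ * ‖w 0‖ := mul_nonneg (norm_nonneg _) (norm_nonneg _)
  have p1 : 0 ≤ ‖y₀ 0 * y₁ 1 - y₀ 1 * y₁ 0‖ * ‖w 1‖ := mul_nonneg (norm_nonneg _) (norm_nonneg _)
  have q0 : (‖y₀ 0 * y₁ 1 - y₀ 1 * y₁ 0‖ * ‖w 0‖) ^ 2 ≤
      2 * ((‖y₁ 1‖ * ‖slotLin y₀ w‖) ^ 2 + (‖y₀ 1‖ * ‖slotLin y₁ w‖) ^ 2) := by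
    nlinarith [sq_nonneg (‖y₁ 1‖ * ‖slotLin y₀ w‖ - ‖y₀ 1‖ * ‖slotLin y₁ w‖)]
  have q1 : (‖y₀ 0 * y₁ 1 - y₀ 1 * y₁ 0‖ * ‖w 1‖) ^ 2 ≤
      2 * ((‖y₀ 0‖ * ‖slotLin y₁ w‖) ^ 2 + (‖y₁ 0‖ * ‖slotLin y₀ w‖) ^ 2) := by
    nlinarith [sq_nonneg (‖y₀ 0‖ * ‖slotLin y₁ w‖ - ‖y₁ 0‖ * ‖slotLin y₀ w‖)]
  have s0 := sq_nonneg ‖slotLin y₀ w‖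
  have s1 := sq_nonneg ‖slotLin y₁ w‖
  have n00 := sq_nonneg ‖y₀ 0‖
  have n01 := sq_nonneg ‖y₀ 1‖
  have n10 := sq_nonneg ‖y₁ 0‖
  have n11 := sq_nonneg ‖y₁ 1‖
  nlinarith [mul_pow (‖y₀ 0 * y₁ 1 - y₀ 1 * y₁ 0‖) (‖w 0‖) 2, mul_pow (‖y₀ 0 * y₁ 1 - y₀ 1 * y₁ 0‖) (‖w 1‖) 2,
    mul_pow ‖y₁ 1‖ ‖slotLin y₀ w‖ 2, mul_pow ‖y₀ 1‖ ‖slotLin y₁ w‖ 2, mul_pow ‖y₀ 0‖ ‖slotLin y₁ w‖ 2,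
    mul_pow ‖y₁ 0‖ ‖slotLin y₀ w‖ 2, mul_nonneg n00 s0, mul_nonneg n01 s0, mul_nonneg n10 s1, mul_nonneg n11 s1,
    mul_nonneg n00 s1, mul_nonneg n01 s1, mul_nonneg n10 s0, mul_nonneg n11 s0]


/-- `0 ≤ nsq z`. -/
theorem zero_le_nsq (z : Fin 2 → ℂ) : 0 ≤ nsq z := by
  unfold nsq; positivity

/-! ## 2. The common zero `z*` of the two slot functions, and why it lies in the ball -/

/-- The common zero of `f(y₀, ·)` and `f(y₁, ·)` (Cramer's rule on `conj z`). -/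
def commonZero (y₀ y₁ : Fin 3 → ℂ) : Fin 2 → ℂ :=
  ![conj ((y₁ 1 * y₀ 2 - y₀ 1 * y₁ 2) / (y₀ 0 * y₁ 1 - y₀ 1 * y₁ 0)),
    conj ((y₀ 0 * y₁ 2 - y₁ 0 * y₀ 2) / (y₀ 0 * y₁ 1 - y₀ 1 * y₁ 0))]

/-- The first coordinate of `z*`. -/
theorem commonZero_zero (y₀ y₁ : Fin 3 → ℂ) :
    commonZero y₀ y₁ 0 = conj ((y₁ 1 * y₀ 2 - y₀ 1 * y₁ 2) / (y₀ 0 * y₁ 1 - y₀ 1 * y₁ 0)) := rfl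

/-- The second coordinate of `z*`. -/
theorem commonZero_one (y₀ y₁ : Fin 3 → ℂ) :
    commonZero y₀ y₁ 1 = conj ((y₀ 0 * y₁ 2 - y₁ 0 * y₀ 2) / (y₀ 0 * y₁ 1 - y₀ 1 * y₁ 0)) := rfl

/-- `f(y₀, z*) = 0`. -/
theorem jform_lift3_commonZero_left (y₀ y₁ : Fin 3 → ℂ) (hab : y₀ 0 * y₁ 1 - y₀ 1 * y₁ 0 ≠ 0) :
    star (lift3 (commonZero y₀ y₁)) ⬝ᵥ (J *ᵥ y₀) = 0 := by
  rw [jform_lift3, commonZero_zero, commonZero_one, Complex.conj_conj, Complex.conj_conj]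
  have hA := div_mul_cancel₀ (y₁ 1 * y₀ 2 - y₀ 1 * y₁ 2) hab
  have hB := div_mul_cancel₀ (y₀ 0 * y₁ 2 - y₁ 0 * y₀ 2) hab
  apply mul_right_cancel₀ hab
  linear_combination y₀ 0 * hA + y₀ 1 * hB

/-- `f(y₁, z*) = 0`. -/
theorem jform_lift3_commonZero_right (y₀ y₁ : Fin 3 → ℂ) (hab : y₀ 0 * y₁ 1 - y₀ 1 * y₁ 0 ≠ 0) :
    star (lift3 (commonZero y₀ y₁)) ⬝ᵥ (J *ᵥ y₁) = 0 := by
  rw [jform_lift3, commonZero_zero, commonZero_one, Complex.conj_conj, Complex.conj_conj]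
  have hA := div_mul_cancel₀ (y₁ 1 * y₀ 2 - y₀ 1 * y₁ 2) hab
  have hB := div_mul_cancel₀ (y₀ 0 * y₁ 2 - y₁ 0 * y₀ 2) hab
  apply mul_right_cancel₀ hab
  linear_combination y₁ 0 * hA + y₁ 1 * hB

/-- **THE `J`-ORTHOGONAL LINE OF A `J`-POSITIVE PLANE IS NEGATIVE:** the common zero lies in the ball. -/
theorem commonZero_mem_ball (y₀ y₁ : Fin 3 → ℂ) (hab : y₀ 0 * y₁ 1 - y₀ 1 * y₁ 0 ≠ 0)
    (hpos : ∀ u v : ℂ, (u ≠ 0 ∨ v ≠ 0) →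
      0 < (star (u • y₀ + v • y₁) ⬝ᵥ (J *ᵥ (u • y₀ + v • y₁))).re) :
    commonZero y₀ y₁ ∈ ball := by
  set zs := commonZero y₀ y₁ with hzs
  have hf0 : conj (zs 0) * y₀ 0 + conj (zs 1) * y₀ 1 - y₀ 2 = 0 := by
    rw [← jform_lift3]; exact jform_lift3_commonZero_left y₀ y₁ hab
  have hf1 : conj (zs 0) * y₁ 0 + conj (zs 1) * y₁ 1 - y₁ 2 = 0 := by
    rw [← jform_lift3]; exact jform_lift3_commonZero_right y₀ y₁ hab
  show nsq zs < 1
  by_contra hcon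
  have hcon' : 1 ≤ nsq zs := not_lt.1 hcon
  -- the coefficients of the vector of the plane whose first two coordinates are `z*`
  set a : ℂ := (zs 0 * y₁ 1 - zs 1 * y₁ 0) / (y₀ 0 * y₁ 1 - y₀ 1 * y₁ 0) with ha
  set b : ℂ := (y₀ 0 * zs 1 - y₀ 1 * zs 0) / (y₀ 0 * y₁ 1 - y₀ 1 * y₁ 0) with hb
  have haΔ : a * (y₀ 0 * y₁ 1 - y₀ 1 * y₁ 0) = zs 0 * y₁ 1 - zs 1 * y₁ 0 := div_mul_cancel₀ _ hab
  have hbΔ : b * (y₀ 0 * y₁ 1 - y₀ 1 * y₁ 0) = y₀ 0 * zs 1 - y₀ 1 * zs 0 := div_mul_cancel₀ _ hab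
  have hp0 : (a • y₀ + b • y₁) 0 = zs 0 := by
    apply mul_right_cancel₀ hab
    simp only [Pi.add_apply, Pi.smul_apply, smul_eq_mul]
    linear_combination y₀ 0 * haΔ + y₁ 0 * hbΔ
  have hp1 : (a • y₀ + b • y₁) 1 = zs 1 := by
    apply mul_right_cancel₀ hab
    simp only [Pi.add_apply, Pi.smul_apply, smul_eq_mul]
    linear_combination y₀ 1 * haΔ + y₁ 1 * hbΔ
  have hp2 : (a • y₀ + b • y₁) 2 = ((nsq zs : ℝ) : ℂ) := by
    have e0 : y₀ 2 = conj (zs 0) * y₀ 0 + conj (zs 1) * y₀ 1 := by linear_combination -hf0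
    have e1 : y₁ 2 = conj (zs 0) * y₁ 0 + conj (zs 1) * y₁ 1 := by linear_combination -hf1
    have h2 : (a • y₀ + b • y₁) 2 = conj (zs 0) * (a • y₀ + b • y₁) 0 + conj (zs 1) * (a • y₀ + b • y₁) 1 := by
      simp only [Pi.add_apply, Pi.smul_apply, smul_eq_mul]
      rw [e0, e1]
      ring
    rw [h2, hp0, hp1, nsq, Complex.ofReal_add, Complex.ofReal_pow, Complex.ofReal_pow,
      ← Complex.conj_mul', ← Complex.conj_mul']
  have hre : (star (a • y₀ + b • y₁) ⬝ᵥ (J *ᵥ (a • y₀ + b • y₁))).re = nsq zs - nsq zs ^ 2 := by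
    rw [jform_self_re, hp0, hp1, hp2, Complex.norm_real, Real.norm_eq_abs,
      abs_of_nonneg (zero_le_nsq zs)]
    rfl
  have hab' : a ≠ 0 ∨ b ≠ 0 := by
    rcases ne_or_eq a 0 with ha0 | ha0
    · exact Or.inl ha0
    rcases ne_or_eq b 0 with hb0 | hb0
    · exact Or.inr hb0
    exfalso
    have h0 : zs 0 = 0 := by rw [← hp0, ha0, hb0]; simp
    have h1 : zs 1 = 0 := by rw [← hp1, ha0, hb0]; simp
    have : nsq zs = 0 := by simp [nsq, h0, h1]
    linarith
  have := hpos a b hab'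
  rw [hre] at this
  nlinarith [zero_le_nsq zs]



end Summit.Ventures.HodgeRepro.Tier4.Line3

end
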